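import Mathlib.AlgebraicTopology.SingularHomology.Basic
import Mathlib.Topology.Category.TopPair
import Mathlib.Topology.Category.TopCat.EpiMono
import Mathlib.Topology.Homeomorph.Lemmas
import Mathlib.Algebra.Homology.HomologySequence
import Mathlib.Algebra.Homology.HomologySequenceLemmas
import Mathlib.Algebra.Homology.HomologicalComplexLimits
import Mathlib.Algebra.Homology.HomologicalComplexAbelian
import Mathlib.Algebra.Category.ModuleCat.Abelian
import Mathlib.Algebra.Category.ModuleCat.Limits
import Mathlib.Algebra.Homology.ShortComplex.ModuleCat
import Mathlib.Topology.Homotopy.Basic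
import Summits.Ventures.HodgeRepro2.HostAPI.Carriers.AlgebraicTopology.SingularHomology.SingularChains
import Summits.Ventures.HodgeRepro2.HostAPI.Util.ForallBinderLint
open HostAPI.Carriers

noncomputable section

open CategoryTheory Limits AlgebraicTopology

universe u v

namespace HostAPI.Carriers.AlgebraicTopology.SingularHomology

variable (R : Type v) [CommRing R] (M : Type v) [AddCommGroup M] [Module R M]
variable {X Y Z : Type u} [TopologicalSpace X] [TopologicalSpace Y] [TopologicalSpace Z]

def subsetRestrict {A : Set X} {B : Set Y} (f : C(X, Y)) (h : Set.MapsTo f A B) : C(A, B) :=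
  ⟨h.restrict f A B, f.continuous.restrict h⟩

@[simp]
lemma subsetRestrict_apply {A : Set X} {B : Set Y} (f : C(X, Y)) (h : Set.MapsTo f A B) (a : A) :
    subsetRestrict f h a = ⟨f a, h a.2⟩ := rfl

@[simp]
lemma subsetRestrict_id (A : Set X) :
    subsetRestrict (ContinuousMap.id X) (Set.mapsTo_id A) = ContinuousMap.id A := rfl

lemma subsetRestrict_comp {A : Set X} {B : Set Y} {C : Set Z} (f : C(X, Y)) (g : C(Y, Z))
    (hf : Set.MapsTo f A B) (hg : Set.MapsTo g B C) :
    subsetRestrict (g.comp f) (hg.comp hf) = (subsetRestrict g hg).comp (subsetRestrict f hf) :=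
  rfl

namespace singularChainComplex

variable (X) in

abbrev subsetι (A : Set X) : singularChainComplex R M A ⟶ singularChainComplex R M X :=
  singularChainComplex.map R M ⟨Subtype.val, continuous_subtype_val⟩

theorem mono_subsetι (A : Set X) : Mono (subsetι R M X A) := by
  haveI : Mono (TopCat.ofHom (⟨Subtype.val, continuous_subtype_val⟩ : C(A, X))) :=
    (TopCat.mono_iff_injective _).2 Subtype.val_injective
  exact Functor.map_mono _ _

@[reassoc]
lemma subsetι_comp_map {A : Set X} {B : Set Y} (f : C(X, Y)) (h : Set.MapsTo f A B) :
    subsetι R M X A ≫ singularChainComplex.map R M f =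
      singularChainComplex.map R M (subsetRestrict f h) ≫ subsetι R M Y B := by
  rw [← singularChainComplex.map_comp, ← singularChainComplex.map_comp]
  rfl

lemma subsetι_eq_zero_of_isEmpty (A : Set X) [IsEmpty A] : subsetι R M X A = 0 := by
  ext n : 1
  exact singularChainComplex.hom_ext fun σ _ ↦
    isEmptyElim (SingularSimplex.toContinuousMap σ (Classical.arbitrary _))

theorem isIso_subsetι_univ : IsIso (subsetι R M X Set.univ) := by
  haveI : IsIso (TopCat.ofHom (⟨Subtype.val, continuous_subtype_val⟩ : C((Set.univ : Set X), X))) :=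
    (TopCat.isoOfHomeo (X := TopCat.of (Set.univ : Set X)) (Y := TopCat.of X)
      (Homeomorph.Set.univ X)).isIso_hom
  exact Functor.map_isIso _ _

end singularChainComplex

variable (X) in

abbrev relativeSingularChainComplex (A : Set X) : ChainComplex (ModuleCat.{max u v} R) ℕ :=
  cokernel (singularChainComplex.subsetι R M X A)

namespace relativeSingularChainComplex

variable (X) in

abbrev π (A : Set X) : singularChainComplex R M X ⟶ relativeSingularChainComplex R M X A :=
  cokernel.π (singularChainComplex.subsetι R M X A)

theorem epi_π (A : Set X) : Epi (π R M X A) :=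
  inferInstanceAs (Epi (cokernel.π _))

@[reassoc]
lemma subsetι_comp_π (A : Set X) : singularChainComplex.subsetι R M X A ≫ π R M X A = 0 :=
  cokernel.condition _

theorem shortExact_subsetι_π (X : Type u) [TopologicalSpace X] (A : Set X) :
    (ShortComplex.mk (singularChainComplex.subsetι R M X A) (π R M X A)
      (cokernel.condition _)).ShortExact := by
  haveI := singularChainComplex.mono_subsetι R M (X := X) A
  haveI := epi_π R M (X := X) A
  exact ShortComplex.ShortExact.mk'
    (ShortComplex.exact_of_g_is_cokernel _ (cokernelIsCokernel _)) inferInstance inferInstance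

def map {A : Set X} {B : Set Y} (f : C(X, Y)) (h : Set.MapsTo f A B) :
    relativeSingularChainComplex R M X A ⟶ relativeSingularChainComplex R M Y B :=
  cokernel.map _ _ (singularChainComplex.map R M (subsetRestrict f h))
    (singularChainComplex.map R M f) (singularChainComplex.subsetι_comp_map R M f h)

@[reassoc (attr := simp)]
lemma π_comp_map {A : Set X} {B : Set Y} (f : C(X, Y)) (h : Set.MapsTo f A B) :
    π R M X A ≫ map R M f h = singularChainComplex.map R M f ≫ π R M Y B :=
  cokernel.π_desc _ _ _

@[simp]
lemma map_id (A : Set X) : map R M (ContinuousMap.id X) (Set.mapsTo_id A) = 𝟙 _ := by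
  haveI := epi_π R M (X := X) A
  rw [← cancel_epi (π R M X A), π_comp_map, singularChainComplex.map_id]
  simp

@[reassoc]
lemma map_comp {A : Set X} {B : Set Y} {C : Set Z} (f : C(X, Y)) (g : C(Y, Z))
    (hf : Set.MapsTo f A B) (hg : Set.MapsTo g B C) :
    map R M (g.comp f) (hg.comp hf) = map R M f hf ≫ map R M g hg := by
  haveI := epi_π R M (X := X) A
  rw [← cancel_epi (π R M X A), π_comp_map, π_comp_map_assoc, π_comp_map,
    singularChainComplex.map_comp, Category.assoc]

def shortComplexMap {A : Set X} {B : Set Y} (f : C(X, Y)) (h : Set.MapsTo f A B) :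
    ShortComplex.mk (singularChainComplex.subsetι R M X A) (π R M X A) (cokernel.condition _) ⟶
      ShortComplex.mk (singularChainComplex.subsetι R M Y B) (π R M Y B) (cokernel.condition _) :=
  ShortComplex.homMk (singularChainComplex.map R M (subsetRestrict f h))
    (singularChainComplex.map R M f) (map R M f h)
    (singularChainComplex.subsetι_comp_map R M f h).symm (π_comp_map R M f h).symm

theorem isIso_π_of_isEmpty (A : Set X) [IsEmpty A] : IsIso (π R M X A) :=
  cokernel.π_of_zero (singularChainComplex.subsetι_eq_zero_of_isEmpty R M A)

theorem isZero_univ : IsZero (relativeSingularChainComplex R M X Set.univ) := by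
  haveI := singularChainComplex.isIso_subsetι_univ R M (X := X)
  exact isZero_cokernel_of_epi _

end relativeSingularChainComplex

variable (X) in

abbrev relativeSingularHomology (A : Set X) (n : ℕ) : ModuleCat.{max u v} R :=
  (relativeSingularChainComplex R M X A).homology n

namespace relativeSingularHomology

def map {A : Set X} {B : Set Y} (f : C(X, Y)) (h : Set.MapsTo f A B) (n : ℕ) :
    relativeSingularHomology R M X A n ⟶ relativeSingularHomology R M Y B n :=
  HomologicalComplex.homologyMap (relativeSingularChainComplex.map R M f h) n

@[simp]
lemma map_id (A : Set X) (n : ℕ) : map R M (ContinuousMap.id X) (Set.mapsTo_id A) n = 𝟙 _ := by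
  rw [map, relativeSingularChainComplex.map_id, HomologicalComplex.homologyMap_id]

@[reassoc]
lemma map_comp {A : Set X} {B : Set Y} {C : Set Z} (f : C(X, Y)) (g : C(Y, Z))
    (hf : Set.MapsTo f A B) (hg : Set.MapsTo g B C) (n : ℕ) :
    map R M (g.comp f) (hg.comp hf) n = map R M f hf n ≫ map R M g hg n := by
  rw [map, relativeSingularChainComplex.map_comp, HomologicalComplex.homologyMap_comp]
  rfl

def map_eq_of_homotopic : Prop :=
  ∀ {A : Set X} {B : Set Y} {f g : C(X, Y)} (hf : Set.MapsTo f A B) (hg : Set.MapsTo g A B) (F : ContinuousMap.Homotopy f g) (hF : ∀ tx : unitInterval × X, tx.2 ∈ A → F tx ∈ B) (n : ℕ),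
    map R M f hf n = map R M g hg n

variable (X) in

def ofAbsolute (A : Set X) (n : ℕ) : singularHomology R M X n ⟶ relativeSingularHomology R M X A n :=
  HomologicalComplex.homologyMap (relativeSingularChainComplex.π R M X A) n

@[reassoc]
lemma ofAbsolute_comp_map {A : Set X} {B : Set Y} (f : C(X, Y)) (h : Set.MapsTo f A B) (n : ℕ) :
    ofAbsolute R M X A n ≫ map R M f h n = singularHomology.map R M f n ≫ ofAbsolute R M Y B n := by
  rw [ofAbsolute, map, ← HomologicalComplex.homologyMap_comp,
    relativeSingularChainComplex.π_comp_map, HomologicalComplex.homologyMap_comp]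
  rfl

variable (X) in

def δ (A : Set X) (n : ℕ) : relativeSingularHomology R M X A (n + 1) ⟶ singularHomology R M A n :=
  (relativeSingularChainComplex.shortExact_subsetι_π R M X A).δ (n + 1) n rfl

@[reassoc (attr := simp)]
lemma map_comp_ofAbsolute (A : Set X) (n : ℕ) :
    singularHomology.map R M (⟨Subtype.val, continuous_subtype_val⟩ : C(A, X)) n ≫
      ofAbsolute R M X A n = 0 := by
  rw [singularHomology.map, ofAbsolute, ← HomologicalComplex.homologyMap_comp,
    relativeSingularChainComplex.subsetι_comp_π, HomologicalComplex.homologyMap_zero]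

@[reassoc (attr := simp)]
lemma ofAbsolute_comp_δ (A : Set X) (n : ℕ) : ofAbsolute R M X A (n + 1) ≫ δ R M X A n = 0 :=
  (relativeSingularChainComplex.shortExact_subsetι_π R M X A).comp_δ (n + 1) n rfl

@[reassoc (attr := simp)]
lemma δ_comp_map (A : Set X) (n : ℕ) :
    δ R M X A n ≫ singularHomology.map R M (⟨Subtype.val, continuous_subtype_val⟩ : C(A, X)) n = 0 :=
  (relativeSingularChainComplex.shortExact_subsetι_π R M X A).δ_comp (n + 1) n rfl

theorem exact_map_ofAbsolute (A : Set X) (n : ℕ) :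
    (ShortComplex.mk _ _ (map_comp_ofAbsolute R M A n)).Exact :=
  (relativeSingularChainComplex.shortExact_subsetι_π R M X A).homology_exact₂ n

theorem exact_ofAbsolute_δ (A : Set X) (n : ℕ) :
    (ShortComplex.mk _ _ (ofAbsolute_comp_δ R M A n)).Exact :=
  (relativeSingularChainComplex.shortExact_subsetι_π R M X A).homology_exact₃ (n + 1) n rfl

theorem exact_δ_map (A : Set X) (n : ℕ) :
    (ShortComplex.mk _ _ (δ_comp_map R M A n)).Exact :=
  (relativeSingularChainComplex.shortExact_subsetι_π R M X A).homology_exact₁ (n + 1) n rfl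

@[reassoc]
theorem δ_naturality {A : Set X} {B : Set Y} (f : C(X, Y)) (h : Set.MapsTo f A B) (n : ℕ) :
    δ R M X A n ≫ singularHomology.map R M (subsetRestrict f h) n =
      map R M f h (n + 1) ≫ δ R M Y B n :=
  HomologicalComplex.HomologySequence.δ_naturality
    (relativeSingularChainComplex.shortComplexMap R M f h)
    (relativeSingularChainComplex.shortExact_subsetι_π R M X A)
    (relativeSingularChainComplex.shortExact_subsetι_π R M Y B) (n + 1) n rfl

theorem isIso_ofAbsolute_of_isEmpty (A : Set X) [IsEmpty A] (n : ℕ) :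
    IsIso (ofAbsolute R M X A n) := by
  haveI := relativeSingularChainComplex.isIso_π_of_isEmpty R M (X := X) A
  exact inferInstanceAs
    (IsIso ((HomologicalComplex.homologyFunctor _ _ n).map (relativeSingularChainComplex.π R M X A)))

variable (X) in

def emptyIso (n : ℕ) : singularHomology R M X n ≅ relativeSingularHomology R M X ∅ n :=
  haveI := isIso_ofAbsolute_of_isEmpty R M (X := X) ∅ n
  asIso (ofAbsolute R M X ∅ n)

@[simp]
lemma emptyIso_hom (n : ℕ) : (emptyIso R M X n).hom = ofAbsolute R M X ∅ n := rfl

end relativeSingularHomology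

theorem isZero_relativeSingularHomology_univ (n : ℕ) :
    IsZero (relativeSingularHomology R M X Set.univ n) :=
  Functor.map_isZero (HomologicalComplex.homologyFunctor _ _ n)
    (relativeSingularChainComplex.isZero_univ R M)

variable (X) in

abbrev reducedSingularHomology (x₀ : X) (n : ℕ) : ModuleCat.{max u v} R :=
  relativeSingularHomology R M X {x₀} n

theorem isZero_relativeSingularHomology_succ_of_epi_of_mono (A : Set X) (n : ℕ)
    [Epi (singularHomology.map R M (⟨Subtype.val, continuous_subtype_val⟩ : C(A, X)) (n + 1))]
    [Mono (singularHomology.map R M (⟨Subtype.val, continuous_subtype_val⟩ : C(A, X)) n)] :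
    IsZero (relativeSingularHomology R M X A (n + 1)) :=
  (relativeSingularHomology.exact_ofAbsolute_δ R M (X := X) A n).isZero_of_both_zeros
    (zero_of_epi_comp (singularHomology.map R M
      (⟨Subtype.val, continuous_subtype_val⟩ : C(A, X)) (n + 1))
      (relativeSingularHomology.map_comp_ofAbsolute R M A (n + 1)))
    (zero_of_comp_mono (singularHomology.map R M
      (⟨Subtype.val, continuous_subtype_val⟩ : C(A, X)) n)
      (relativeSingularHomology.δ_comp_map R M A n))

theorem isZero_relativeSingularHomology_succ_of_isIso_map (A : Set X)
    (h : ∀ k, IsIso (singularHomology.map R M (⟨Subtype.val, continuous_subtype_val⟩ : C(A, X)) k))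
    (n : ℕ) : IsZero (relativeSingularHomology R M X A (n + 1)) := by
  haveI := h (n + 1)
  haveI := h n
  exact isZero_relativeSingularHomology_succ_of_epi_of_mono R M A n

end HostAPI.Carriers.AlgebraicTopology.SingularHomology
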